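import Literature.Geometry.Kaehler.NearlyComplexPlanes
import Literature.NumberTheory.Transcendental.ComplexFormsMixedType
import HarnessLib

/-!
# Off-type forms are `O(t)` on nearly complex planes

Topic `Literature/Geometry/Kaehler`. Sequel to `NearlyComplexPlanes.lean` (adapted orthonormal bases
`(e, f)`, `‖f_j - i e_j‖ = O(t)`, of a real `2m`-plane `V` of defect `t` in a finite-dimensional
complex inner product space `E`) and `ComplexFormsMixedType.lean` (an off-type form — weight
`p - q ≠ 0` in `p + q` slots — vanishes on complex subspaces of half its degree). Combining them:

* `apply_eq_zero_of_weight_of_forall_mem_of_le`, `apply_append_I_smul_eq_zero_of_weight` — an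
  off-type `k`-form vanishes on any `k` vectors of a complex subspace of dimension `≤ k/2`, in
  particular on every frame `(e₁, …, e_m, i e₁, …, i e_m)`;
* `norm_apply_append_sub_le` — `‖φ(e, f) - φ(e, g)‖ ≤ ‖φ‖ · 2m · max_j ‖f_j - g_j‖` for frames of
  vectors of norm `≤ 1` (`ContinuousMultilinearMap.norm_image_sub_le`);
* `exists_adapted_frame_norm_apply_le_of_defect` — hence on the adapted orthonormal basis of a
  `2m`-plane `V` of defect `t` (`0 ≤ t`, `2 · 5ᵐ · t ≤ 1`), `‖φ(e, f)‖ ≤ ‖φ‖ · 2m · 2 · 5ᵐ · t`;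
* `norm_apply_eq_of_orthonormal` — the value of a real-alternating `k`-form on an orthonormal basis
  of a real `k`-plane does not depend on the basis up to sign (top-degree form on the plane,
  orthogonal change of basis has determinant `±1`);
* `norm_apply_le_of_defect_of_weight` — **so EVERY orthonormal basis `u` of `V` has
  `‖φ u‖ ≤ ‖φ‖ · 2m · 2 · 5ᵐ · t`**: the pointwise estimate "an off-type `(r, s)`-form restricted to
  a `t`-nearly complex `(r + s)`-plane is `O(t)` times the volume form" of the threshold lemma
  (`ThresholdForcesHodgeType`) of the Hodge summit's route *HolomorphicityRate*; at `t = 0` it is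
  the vanishing of off-type forms on complex planes behind Wirtinger's inequality
  (Harvey–Lawson (1982), §II.1).

Theorems only; the real inner product `re ⟪·, ·⟫_ℂ` (`InnerProductSpace.complexToReal`) is used
inside proofs, statements are phrased with `re ⟪·, ·⟫_ℂ` and norms.

## References

* R. Harvey, H. B. Lawson, *Calibrated geometries*, Acta Math. 148 (1982), §II.1. [HarveyLawson1982]
* C. Voisin, *Hodge Theory and Complex Algebraic Geometry I* (2002), §2.3.1. [VoisinHodgeI2002]
* D. McDuff, D. Salamon, *Introduction to Symplectic Topology*, 3rd ed. (2017), §2.5. [McDuffSalamon2017]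
-/

noncomputable section

open scoped InnerProductSpace
open Module Submodule

namespace Literature.Geometry.Kaehler

/-! ### Off-type forms are `O(t)` on nearly complex planes -/

section OffType

open Literature.NumberTheory.Transcendental

variable {E : Type*} [NormedAddCommGroup E] [InnerProductSpace ℂ E] [FiniteDimensional ℂ E]

/-- **An off-type form vanishes on every family spanning a complex subspace of at most half its
degree.** A real-alternating `k`-form of weight `p - q`, `p + q = k`, `p ≠ q`, vanishes on any
`k` vectors of a complex subspace `W` with `2 dim_ℂ W ≤ k`: if `2 dim W = k` this is
`apply_eq_zero_of_weight_of_forall_mem` (`ComplexFormsMixedType`); if `2 dim W < k` the `k` vectors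
are `ℝ`-linearly dependent. In particular it vanishes on `(e₁, …, e_m, i e₁, …, i e_m)` for ANY
vectors `e_j`. [cite: HarveyLawson1982, §II.1] [cite: VoisinHodgeI2002, §2.3.1] -/
theorem apply_eq_zero_of_weight_of_forall_mem_of_le {k p q : ℕ} (hk : p + q = k) (hpq : p ≠ q)
    (φ : E [⋀^Fin k]→L[ℝ] ℂ)
    (hφ : ∀ (θ : ℝ) (v : Fin k → E), φ (fun i ↦ Complex.exp (θ * Complex.I) • v i) =
      Complex.exp ((((p : ℤ) - q : ℤ) : ℂ) * θ * Complex.I) * φ v)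
    (W : Submodule ℂ E) (hW : 2 * finrank ℂ W ≤ k) (v : Fin k → E) (hv : ∀ i, v i ∈ W) :
    φ v = 0 := by
  rcases hW.eq_or_lt with h | h
  · exact apply_eq_zero_of_weight_of_forall_mem hk hpq φ hφ W h v hv
  · have hdep : ¬ LinearIndependent ℝ v := by
      intro hli
      let v' : Fin k → W := fun i ↦ ⟨v i, hv i⟩
      have hli' : LinearIndependent ℝ v' :=
        LinearIndependent.of_comp ((W.subtype).restrictScalars ℝ) hli
      have hcard := hli'.fintype_card_le_finrank
      rw [Fintype.card_fin] at hcard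
      have h2 : finrank ℝ W = 2 * finrank ℂ W := by
        rw [← Module.finrank_mul_finrank ℝ ℂ W, Complex.finrank_real_complex]
      omega
    exact φ.toAlternatingMap.map_linearDependent v hdep

/-- The frame `(e, i e) = (e₁, …, e_m, i e₁, …, i e_m)` spans a complex subspace of dimension `≤ m`,
so every off-type `2m`-form vanishes on it. [cite: HarveyLawson1982, §II.1] -/
theorem apply_append_I_smul_eq_zero_of_weight {m p q : ℕ} (hk : p + q = m + m) (hpq : p ≠ q)
    (φ : E [⋀^Fin (m + m)]→L[ℝ] ℂ)
    (hφ : ∀ (θ : ℝ) (v : Fin (m + m) → E), φ (fun i ↦ Complex.exp (θ * Complex.I) • v i) =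
      Complex.exp ((((p : ℤ) - q : ℤ) : ℂ) * θ * Complex.I) * φ v)
    (e : Fin m → E) : φ (Fin.append e fun j ↦ Complex.I • e j) = 0 := by
  refine apply_eq_zero_of_weight_of_forall_mem_of_le hk hpq φ hφ (span ℂ (Set.range e))
    ((Nat.mul_le_mul_left 2 (finrank_range_le_card e)).trans (by rw [Fintype.card_fin]; omega))
    _ fun i ↦ ?_
  refine Fin.addCases (fun j ↦ ?_) (fun j ↦ ?_) i
  · rw [Fin.append_left]
    exact subset_span ⟨j, rfl⟩
  · rw [Fin.append_right]
    exact Submodule.smul_mem _ _ (subset_span ⟨j, rfl⟩)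

omit [FiniteDimensional ℂ E] in
/-- **Frame comparison**: for frames `(e, f)` and `(e, g)` of vectors of norm `≤ 1` with
`‖f_j - g_j‖ ≤ δ`, `‖φ(e, f) - φ(e, g)‖ ≤ ‖φ‖ · 2m · δ`
(`ContinuousMultilinearMap.norm_image_sub_le`). [folklore] -/
theorem norm_apply_append_sub_le {m : ℕ} (φ : E [⋀^Fin (m + m)]→L[ℝ] ℂ) (e f g : Fin m → E)
    (he : ∀ j, ‖e j‖ ≤ 1) (hf : ∀ j, ‖f j‖ ≤ 1) (hg : ∀ j, ‖g j‖ ≤ 1) {δ : ℝ} (hδ : 0 ≤ δ)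
    (hfg : ∀ j, ‖f j - g j‖ ≤ δ) :
    ‖φ (Fin.append e f) - φ (Fin.append e g)‖ ≤ ‖φ‖ * (m + m) * δ := by
  have hu : ‖Fin.append e f‖ ≤ 1 := by
    refine (pi_norm_le_iff_of_nonneg zero_le_one).2 fun i ↦ Fin.addCases (fun j ↦ ?_) (fun j ↦ ?_) i
    · rw [Fin.append_left]; exact he j
    · rw [Fin.append_right]; exact hf j
  have hu' : ‖Fin.append e g‖ ≤ 1 := by
    refine (pi_norm_le_iff_of_nonneg zero_le_one).2 fun i ↦ Fin.addCases (fun j ↦ ?_) (fun j ↦ ?_) i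
    · rw [Fin.append_left]; exact he j
    · rw [Fin.append_right]; exact hg j
  have hdiff : ‖Fin.append e f - Fin.append e g‖ ≤ δ := by
    refine (pi_norm_le_iff_of_nonneg hδ).2 fun i ↦ Fin.addCases (fun j ↦ ?_) (fun j ↦ ?_) i
    · rw [Pi.sub_apply, Fin.append_left, Fin.append_left, sub_self, norm_zero]; exact hδ
    · rw [Pi.sub_apply, Fin.append_right, Fin.append_right]; exact hfg j
  have hmax : max ‖Fin.append e f‖ ‖Fin.append e g‖ ^ (Fintype.card (Fin (m + m)) - 1) ≤ 1 :=
    pow_le_one₀ (by positivity) (max_le hu hu')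
  have h := φ.toContinuousMultilinearMap.norm_image_sub_le (Fin.append e f) (Fin.append e g)
  rw [ContinuousAlternatingMap.norm_toContinuousMultilinearMap, Fintype.card_fin] at h
  rw [Fintype.card_fin] at hmax
  calc ‖φ (Fin.append e f) - φ (Fin.append e g)‖
      ≤ ‖φ‖ * ↑(m + m) * max ‖Fin.append e f‖ ‖Fin.append e g‖ ^ (m + m - 1) *
          ‖Fin.append e f - Fin.append e g‖ := h
    _ ≤ ‖φ‖ * ↑(m + m) * 1 * δ := by
        gcongr
    _ = ‖φ‖ * (m + m) * δ := by push_cast; ring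

/-- **Off-type forms are `O(t)` on nearly complex planes (adapted frame).** Let `E` be a
finite-dimensional complex inner product space, `φ` a real-alternating `2m`-form of weight
`p - q`, `p + q = 2m`, `p ≠ q` (type `(p, q)`, off the middle type `(m, m)`), and `V ⊆ E` a real
`2m`-plane, nearly complex with defect `≤ t`, `0 ≤ t`, `2 · 5ᵐ · t ≤ 1`. Then `V` has an
orthonormal basis `(e₁, …, e_m, f₁, …, f_m)` (real inner product `re ⟪·, ·⟫_ℂ`) on which
`‖φ(e, f)‖ ≤ ‖φ‖ · 2m · 2 · 5ᵐ · t`: indeed `φ(e, i e) = 0` (`apply_append_I_smul_eq_zero_of_weight`)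
and `‖f_j - i e_j‖ ≤ 2 · 5ᵐ · t` (`exists_adapted_orthonormal_of_defect_complex`). This is the
pointwise estimate "an off-type `(r, s)`-form restricted to a `t`-nearly complex plane is `O(t)`"
of the threshold lemma of route *HolomorphicityRate* (Hodge summit); for `t = 0` it is the
vanishing of off-type forms on complex planes behind Wirtinger's inequality.
[cite: HarveyLawson1982, §II.1] [cite: McDuffSalamon2017, §2.5] -/
theorem exists_adapted_frame_norm_apply_le_of_defect {m p q : ℕ} (hk : p + q = m + m) (hpq : p ≠ q)
    (φ : E [⋀^Fin (m + m)]→L[ℝ] ℂ)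
    (hφ : ∀ (θ : ℝ) (v : Fin (m + m) → E), φ (fun i ↦ Complex.exp (θ * Complex.I) • v i) =
      Complex.exp ((((p : ℤ) - q : ℤ) : ℂ) * θ * Complex.I) * φ v)
    (V : Submodule ℝ E) (t : ℝ) (ht : 0 ≤ t) (hmt : 2 * 5 ^ m * t ≤ 1)
    (hdim : finrank ℝ V = 2 * m) (hV : ∀ v ∈ V, ∃ w ∈ V, ‖Complex.I • v - w‖ ≤ t * ‖v‖) :
    ∃ e f : Fin m → E, (∀ j, e j ∈ V) ∧ (∀ j, f j ∈ V) ∧ (∀ j, ‖e j‖ = 1) ∧ (∀ j, ‖f j‖ = 1) ∧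
      (∀ i j, i ≠ j → (⟪e i, e j⟫_ℂ).re = 0) ∧ (∀ i j, i ≠ j → (⟪f i, f j⟫_ℂ).re = 0) ∧
      (∀ i j, (⟪e i, f j⟫_ℂ).re = 0) ∧
      ‖φ (Fin.append e f)‖ ≤ ‖φ‖ * (m + m) * (2 * 5 ^ m * t) := by
  obtain ⟨e, f, heV, hfV, he1, hf1, hee, hff, hef, hbd⟩ :=
    exists_adapted_orthonormal_of_defect_complex m V t ht hmt hdim hV
  refine ⟨e, f, heV, hfV, he1, hf1, hee, hff, hef, ?_⟩
  have h0 := apply_append_I_smul_eq_zero_of_weight hk hpq φ hφ e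
  have h := norm_apply_append_sub_le φ e f (fun j ↦ Complex.I • e j) (fun j ↦ (he1 j).le)
    (fun j ↦ (hf1 j).le) (fun j ↦ by rw [norm_I_smul_eq, he1 j]) (by positivity) hbd
  rwa [h0, sub_zero] at h

omit [FiniteDimensional ℂ E] in
/-- **Change of orthonormal frame.** For two orthonormal bases `u`, `a` of a real subspace `V`
(families of `dim V` unit vectors of `V`, pairwise orthogonal for `re ⟪·, ·⟫_ℂ`), a real-alternating
form takes values of the same norm, `‖φ u‖ = ‖φ a‖`: restricted to `V`, `φ` is a top-degree form,
so `φ a = det_u(a) · φ u` (`AlternatingMap.eq_smul_basis_det`), and the change-of-basis determinant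
between orthonormal bases is `±1` (`OrthonormalBasis.det_to_matrix_orthonormalBasis_real`).
[folklore] -/
theorem norm_apply_eq_of_orthonormal {k : ℕ} (φ : E [⋀^Fin k]→L[ℝ] ℂ) (V : Submodule ℝ E)
    (hdim : finrank ℝ V = k) (u a : Fin k → E) (huV : ∀ i, u i ∈ V) (haV : ∀ i, a i ∈ V)
    (hu1 : ∀ i, ‖u i‖ = 1) (hu : ∀ i j, i ≠ j → (⟪u i, u j⟫_ℂ).re = 0)
    (ha1 : ∀ i, ‖a i‖ = 1) (ha : ∀ i j, i ≠ j → (⟪a i, a j⟫_ℂ).re = 0) :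
    ‖φ u‖ = ‖φ a‖ := by
  letI : InnerProductSpace ℝ E := InnerProductSpace.complexToReal
  rcases Nat.eq_zero_or_pos k with rfl | hk
  · rw [show u = a from funext fun i ↦ i.elim0]
  haveI : Nonempty (Fin k) := ⟨⟨0, hk⟩⟩
  -- orthonormal families of `V`
  have horth : ∀ (w : Fin k → V), (∀ i, ‖(w i : E)‖ = 1) →
      (∀ i j, i ≠ j → (⟪(w i : E), w j⟫_ℂ).re = 0) → Orthonormal ℝ w := by
    intro w hw1 hw
    rw [← V.subtypeₗᵢ.orthonormal_comp_iff, orthonormal_iff_ite]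
    intro i j
    change ⟪(w i : E), w j⟫_ℝ = _
    split_ifs with hij
    · rw [hij, real_inner_self_eq_norm_sq, hw1, one_pow]
    · rw [real_inner_eq_re_inner ℂ]
      exact hw i j hij
  set u' : Fin k → V := fun i ↦ ⟨u i, huV i⟩ with hu'_def
  set a' : Fin k → V := fun i ↦ ⟨a i, haV i⟩ with ha'_def
  have hu' : Orthonormal ℝ u' := horth u' hu1 hu
  have ha' : Orthonormal ℝ a' := horth a' ha1 ha
  have hcard : Fintype.card (Fin k) = finrank ℝ V := by rw [Fintype.card_fin, hdim]
  let bu : Basis (Fin k) ℝ V := basisOfOrthonormalOfCardEqFinrank hu' hcard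
  let ba : Basis (Fin k) ℝ V := basisOfOrthonormalOfCardEqFinrank ha' hcard
  have hbu : (bu : Fin k → V) = u' := coe_basisOfOrthonormalOfCardEqFinrank hu' hcard
  have hba : (ba : Fin k → V) = a' := coe_basisOfOrthonormalOfCardEqFinrank ha' hcard
  -- the change-of-basis determinant is `±1`
  have hdet : bu.det a' = 1 ∨ bu.det a' = -1 := by
    have h := (bu.toOrthonormalBasis (hbu ▸ hu')).det_to_matrix_orthonormalBasis_real
      (ba.toOrthonormalBasis (hba ▸ ha'))
    rwa [Module.Basis.toBasis_toOrthonormalBasis, Module.Basis.coe_toOrthonormalBasis, hba] at h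
  -- `φ a = det • φ u` through the real and imaginary parts of `φ|_V`
  let ψ : V [⋀^Fin k]→ₗ[ℝ] ℂ := φ.toAlternatingMap.compLinearMap V.subtype
  have hψ : ∀ w : Fin k → V, ψ w = φ (fun i ↦ (w i : E)) := fun w ↦ rfl
  have key : ∀ L : ℂ →ₗ[ℝ] ℝ, L (φ a) = bu.det a' * L (φ u) := by
    intro L
    have h := congrArg (fun g : V [⋀^Fin k]→ₗ[ℝ] ℝ ↦ g a') ((L.compAlternatingMap ψ).eq_smul_basis_det bu)
    simp only [AlternatingMap.smul_apply, LinearMap.compAlternatingMap_apply, smul_eq_mul] at h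
    rw [hψ, hbu, hψ] at h
    rw [mul_comm]
    exact h
  have hφa : φ a = (bu.det a' : ℂ) * φ u := by
    apply Complex.ext
    · rw [Complex.re_ofReal_mul]; exact key Complex.reLm
    · rw [Complex.im_ofReal_mul]; exact key Complex.imLm
  rw [hφa, norm_mul, Complex.norm_real, Real.norm_eq_abs]
  rcases hdet with h | h <;> rw [h] <;> simp

/-- **Off-type forms are `O(t)` on nearly complex planes (any orthonormal frame).** With `φ`, `V`,
`t` as in `exists_adapted_frame_norm_apply_le_of_defect`, EVERY orthonormal basis `u` of `V`
(`2m` unit vectors of `V`, pairwise orthogonal for `re ⟪·, ·⟫_ℂ`) satisfies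
`‖φ u‖ ≤ ‖φ‖ · 2m · 2 · 5ᵐ · t` (`norm_apply_eq_of_orthonormal`: the value on an orthonormal
frame of `V` does not depend on the frame up to sign). This is the form in which the estimate
enters integration over a nearly holomorphic cycle support (the integrand of an off-type form
against the volume measure is pointwise `O(t)`). [cite: HarveyLawson1982, §II.1] -/
theorem norm_apply_le_of_defect_of_weight {m p q : ℕ} (hk : p + q = m + m) (hpq : p ≠ q)
    (φ : E [⋀^Fin (m + m)]→L[ℝ] ℂ)
    (hφ : ∀ (θ : ℝ) (v : Fin (m + m) → E), φ (fun i ↦ Complex.exp (θ * Complex.I) • v i) =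
      Complex.exp ((((p : ℤ) - q : ℤ) : ℂ) * θ * Complex.I) * φ v)
    (V : Submodule ℝ E) (t : ℝ) (ht : 0 ≤ t) (hmt : 2 * 5 ^ m * t ≤ 1)
    (hdim : finrank ℝ V = 2 * m) (hV : ∀ v ∈ V, ∃ w ∈ V, ‖Complex.I • v - w‖ ≤ t * ‖v‖)
    (u : Fin (m + m) → E) (huV : ∀ i, u i ∈ V) (hu1 : ∀ i, ‖u i‖ = 1)
    (hu : ∀ i j, i ≠ j → (⟪u i, u j⟫_ℂ).re = 0) :
    ‖φ u‖ ≤ ‖φ‖ * (m + m) * (2 * 5 ^ m * t) := by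
  obtain ⟨e, f, heV, hfV, he1, hf1, hee, hff, hef, hbd⟩ :=
    exists_adapted_frame_norm_apply_le_of_defect hk hpq φ hφ V t ht hmt hdim hV
  -- the adapted frame `(e, f)` is an orthonormal basis of `V`
  have haV : ∀ i, Fin.append e f i ∈ V := fun i ↦ by
    refine Fin.addCases (fun j ↦ ?_) (fun j ↦ ?_) i
    · rw [Fin.append_left]; exact heV j
    · rw [Fin.append_right]; exact hfV j
  have ha1 : ∀ i, ‖Fin.append e f i‖ = 1 := fun i ↦ by
    refine Fin.addCases (fun j ↦ ?_) (fun j ↦ ?_) i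
    · rw [Fin.append_left]; exact he1 j
    · rw [Fin.append_right]; exact hf1 j
  have ha : ∀ i j, i ≠ j → (⟪Fin.append e f i, Fin.append e f j⟫_ℂ).re = 0 := by
    intro i j hij
    induction i using Fin.addCases with
    | left i =>
      induction j using Fin.addCases with
      | left j =>
        rw [Fin.append_left, Fin.append_left]
        exact hee i j fun h ↦ hij (by rw [h])
      | right j => rw [Fin.append_left, Fin.append_right]; exact hef i j
    | right i =>
      induction j using Fin.addCases with
      | left j =>
        rw [Fin.append_right, Fin.append_left, ← inner_conj_symm, Complex.conj_re]
        exact hef j i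
      | right j =>
        rw [Fin.append_right, Fin.append_right]
        exact hff i j fun h ↦ hij (by rw [h])
  rw [norm_apply_eq_of_orthonormal φ V (by rw [hdim]; ring) u (Fin.append e f) huV haV hu1 hu ha1 ha]
  exact hbd

end OffType

end Literature.Geometry.Kaehler

end
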